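import Summits.AnomalousDissipation.AnomalousDissipation.Theorems.SawtoothPulseCascadeK1LocalisedCascadeKHSheetPairEnergy
import Summits.AnomalousDissipation.AnomalousDissipation.Theorems.SawtoothPulseCascadeK1LocalisedCascadeKHStableRotation

/-!
# K2 lane (route-2 `SawtoothPulseCascade`, crux dir `K1LocalisedCascade`): UPPER Gram bound — the energy of a sheet pair is at most `(−Σ₀ + |S|)(|q₊|² + |q₋|²)/(2π)`

Companion of `khGram_ge` (p678850) and `sheetPair_energy_hasSum'` (p687541) for the K2 lane's forced step (ACL item stmt-AnomalousDissipation-19491): once the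
created amplitudes `q = sheetAmps …` are bounded componentwise (`…KHComponentAssembly`, crux `K2StableCreation.lean`), the created ENERGY follows from
* `khForm_le_upper`: `−Σ₀(|q₀|² + |q₁|²) − 2Re(q̄₀ S q₁) ≤ (−Σ₀ + |S|)(|q₀|² + |q₁|²)` (`k > 0`; Cauchy–Schwarz on the off-diagonal term);
* `sheetPair_energy_le`: `Σ_n |ζ̂(n)|²/(4π²(a²+(β+n)²)) ≤ (−Σ₀(a,−β) + |S_{−β}(a)|)(|q₊|² + |q₋|²)/(2π)` for the bare pair;
* `gram_upper_le`: `−Σ₀(k,β) + |S_β(k)| ≤ (1 + √q)²/(2k(1−q)) · …` is NOT needed here; instead the clean bound `−Σ₀ + |S| ≤ (1+q)/(2k(1−q)) + √q/(k(1−q))`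
  (`le_sawSigma0_of_pos`, `normSq_sawS_le`), i.e. `≤ 0.56/k` for `k ≥ 1` (`gram_upper_le_of_one_le`).
No definitions; no statement about the crux. [cite: Drazin2002, §8.3 (8.36)–(8.38)] [problem: turb]
-/

-- `Summit.<Summit>.<Problem>`: single-conjunct summit, the duplicate namespace segment is deliberate.
set_option linter.dupNamespace false

noncomputable section

namespace Summit.AnomalousDissipation.AnomalousDissipation.Theorems.SawtoothPulseCascade.K2PhaseBudget

open Set Literature.Analysis.FluidPDE.SawtoothCascade

/-- **Upper Gram bound:** `−Σ₀(|q₀|²+|q₁|²) − 2Re(q̄₀ S q₁) ≤ (−Σ₀ + |S|)(|q₀|²+|q₁|²)`. [cite: Drazin2002, §8.3 (8.36)–(8.38)] -/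
theorem khForm_le_upper (k β : ℝ) (q₀ q₁ : ℂ) :
    -sawSigma0 k β * (Complex.normSq q₀ + Complex.normSq q₁) - 2 * ((starRingEnd ℂ) q₀ * sawS k β * q₁).re ≤
      (-sawSigma0 k β + Real.sqrt (Complex.normSq (sawS k β))) * (Complex.normSq q₀ + Complex.normSq q₁) := by
  set S := sawS k β
  have hre : |((starRingEnd ℂ) q₀ * S * q₁).re| ≤ ‖q₀‖ * Real.sqrt (Complex.normSq S) * ‖q₁‖ := by
    have h1 := Complex.abs_re_le_norm ((starRingEnd ℂ) q₀ * S * q₁)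
    rw [norm_mul, norm_mul, Complex.norm_conj] at h1
    have h2 : ‖S‖ = Real.sqrt (Complex.normSq S) := rfl
    rw [← h2]; linarith
  have hn0 : Complex.normSq q₀ = ‖q₀‖ ^ 2 := (Complex.sq_norm q₀).symm
  have hn1 : Complex.normSq q₁ = ‖q₁‖ ^ 2 := (Complex.sq_norm q₁).symm
  rw [hn0, hn1]
  have hs0 : 0 ≤ Real.sqrt (Complex.normSq S) := Real.sqrt_nonneg _
  have hamgm : 2 * (‖q₀‖ * Real.sqrt (Complex.normSq S) * ‖q₁‖) ≤ Real.sqrt (Complex.normSq S) * (‖q₀‖ ^ 2 + ‖q₁‖ ^ 2) := by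
    nlinarith [mul_nonneg hs0 (sq_nonneg (‖q₀‖ - ‖q₁‖))]
  have habs' := (abs_le.1 hre).1
  nlinarith

/-- **The energy of a bare sheet pair is at most `(−Σ₀(a,−β) + |S_{−β}(a)|)(|q₊|² + |q₋|²)/(2π)`** (`a > 0`). [cite: Drazin2002, §8.3 (8.36)–(8.38)] -/
theorem sheetPair_energy_le {a : ℝ} (ha : 0 < a) (β : ℝ) (qp qm : ℂ) :
    ∑' n : ℤ, ‖qp * Complex.exp (-(2 * Real.pi * (β + n) * (1 / 4 : ℝ) : ℝ) * Complex.I) +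
          qm * Complex.exp (-(2 * Real.pi * (β + n) * (-(1 / 4 : ℝ)) : ℝ) * Complex.I)‖ ^ 2 / (4 * Real.pi ^ 2 * (a ^ 2 + (β + n) ^ 2)) ≤
      (-sawSigma0 a (-β) + Real.sqrt (Complex.normSq (sawS a (-β)))) * (Complex.normSq qp + Complex.normSq qm) / (2 * Real.pi) := by
  rw [(sheetPair_energy_hasSum' ha β qp qm).tsum_eq]
  exact div_le_div_of_nonneg_right (khForm_le_upper a (-β) qp qm) (by positivity)

/-- `−Σ₀(k,β) + |S_β(k)| ≤ (1+q)/(2k(1−q)) + √q/(k(1−q))` for `k > 0` (`q = e^{−2πk}`). [cite: Drazin2002, §8.3 (8.36)–(8.38)] -/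
theorem gram_upper_le {k : ℝ} (hk : 0 < k) (β : ℝ) :
    -sawSigma0 k β + Real.sqrt (Complex.normSq (sawS k β)) ≤ (1 + sawQ k) / (2 * k * (1 - sawQ k)) + Real.sqrt (sawQ k) / (k * (1 - sawQ k)) := by
  have h1 := le_sawSigma0_of_pos hk β
  have hq0 : 0 < sawQ k := sawQ_pos k
  have hq1 : sawQ k < 1 := sawQ_lt_one hk
  have h1q : 0 < 1 - sawQ k := by linarith
  have h2 : Real.sqrt (Complex.normSq (sawS k β)) ≤ Real.sqrt (sawQ k) / (k * (1 - sawQ k)) := by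
    have h := normSq_sawS_le hk β
    calc Real.sqrt (Complex.normSq (sawS k β)) ≤ Real.sqrt (sawQ k / (k ^ 2 * (1 - sawQ k) ^ 2)) := Real.sqrt_le_sqrt h
      _ = Real.sqrt (sawQ k) / (k * (1 - sawQ k)) := by
          rw [Real.sqrt_div' _ , show k ^ 2 * (1 - sawQ k) ^ 2 = (k * (1 - sawQ k)) ^ 2 by ring, Real.sqrt_sq (by positivity)]
          positivity
  have e : -(1 + sawQ k) / (2 * k * (1 - sawQ k)) = -((1 + sawQ k) / (2 * k * (1 - sawQ k))) := by rw [neg_div]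
  rw [e] at h1
  linarith

/-- For `k ≥ 1`: `−Σ₀(k,β) + |S_β(k)| ≤ 0.56/k` (`q ≤ 1/400`, `√q ≤ 1/20`). [cite: Drazin2002, §8.3 (8.36)–(8.38)] -/
theorem gram_upper_le_of_one_le {k : ℝ} (hk : 1 ≤ k) (β : ℝ) :
    -sawSigma0 k β + Real.sqrt (Complex.normSq (sawS k β)) ≤ 0.56 / k := by
  have hk0 : 0 < k := by linarith
  have h := gram_upper_le hk0 β
  have hq0 : 0 < sawQ k := sawQ_pos k
  have hq := sawQ_le_of_one_le hk
  have hsq : Real.sqrt (sawQ k) ≤ 1 / 20 := by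
    rw [show (1 / 20 : ℝ) = Real.sqrt ((1 / 20) ^ 2) by rw [Real.sqrt_sq (by norm_num)]]
    exact Real.sqrt_le_sqrt (by nlinarith)
  have h1q : 0 < 1 - sawQ k := by linarith
  have b1 : (1 + sawQ k) / (2 * k * (1 - sawQ k)) ≤ (401 / 798) / k := by
    rw [div_le_div_iff₀ (by positivity) hk0]
    nlinarith
  have b2 : Real.sqrt (sawQ k) / (k * (1 - sawQ k)) ≤ (20 / 399) / k := by
    rw [div_le_div_iff₀ (by positivity) hk0]
    have := Real.sqrt_nonneg (sawQ k)
    nlinarith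
  have b3 : (401 / 798 : ℝ) / k + (20 / 399) / k ≤ 0.56 / k := by
    rw [← add_div]; exact div_le_div_of_nonneg_right (by norm_num) hk0.le
  linarith

end Summit.AnomalousDissipation.AnomalousDissipation.Theorems.SawtoothPulseCascade.K2PhaseBudget

end
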